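import Summits.QuantumFields.YangMills.Theorems.BalabanLadderNTMarkovMirrorFloor
import Summits.QuantumFields.YangMills.Theorems.BalabanLadderNTReferencePackageScales
import Summits.QuantumFields.YangMills.Theses.BalabanLadder
import HarnessLib

/-!
# Crux `NT` (stmt-QuantumFields-19353) / `UVSeamRec.stub_floorsEngine` (stmt-QuantumFields-20043):
# clause (i) of `LowerBounds` — and `NT` by name — from the Markov–mirror package of card E

Fourth file of the Markov–mirror series (fleet lead prover of crux `UVSeamRec`, unit `ym-spine-20043-p1`, g6).
It discharges the card's sorried bookkeeping `lowerBounds_fst_of_mmf` / `nt_of_markovMirror`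
(`Cruxes/NT/Ideas/markov-mirror-dirichlet-response.md`, Sketch §E) with every clause of the package as an explicit
hypothesis (no package `def`; the hypotheses are implied by the Sketch's `RPCS ∧ ShiftCeiling ∧ MMF`, `RPCS` being the
tree theorem `Reflection.sq_cov_negReflect_le_odd_pos`):

* §1 `isCylinder_sum`, `continuous_cubeSmear`, `exists_abs_cubeSmear_le`, `exists_isCylinder_cubeSmear` — the smeared action density `Ṽ_v = ∑_{y ∈ Q} v(aβ·y) dens_y` carried
  by a cube is a bounded continuous cylinder observable with links in the cube window;
* §2 `Q2_floor_of_mirrorPackage` — for a unit map `a → 0⁺`, ONE test function `v`, `ε > 0`, a family of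
  positive-time cubes `Q_β` of physical size `≤ Λ₅` carrying bounded continuous cylinders `W_β` (the application:
  `W_β = Ṽ_v`), shell functionals `𝒢_β` on the closed collars, reference values `p β`, with (RBL+SUP)
  `|kerE_{Q_β}^ζ(W_β) − p β + 𝒢_β ζ| ≤ √ε/2` for every exterior, (SF) `Cov_T(𝒢_β∘Θ₀, 𝒢_β) ≥ 4ε` on every torus
  `a β·L ≥ Λ₅`, and (ShiftCeiling) `|Cov_T(W_β∘Θ₀, W_β) − Q2_{β,L,aβ}(θv, v)| ≤ C·aβ`: for all large `β` and all tori
  `a β·L ≥ Λ₅'`, `ε ≤ Q2 G r β L (a β) (θv) v` (per coupling `mirrorCov_ge_of_boundaryResponse` gives `9ε/4`, and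
  `a β → 0` eats the shift term);
* §3 `lowerBounds_fst_of_mirrorPackage` — clause (i) of `LowerBounds G r a` (with the SAME `v`, `ε`);
  `nt_of_markovMirror` — `Summit.QuantumFields.YangMills.Theses.BalabanLadder.NT` BY NAME from, for every compact
  simple `G`, a representation, a unit map, the mirror package for clause (i) and ANY supplier of clause (ii).

What the package still OWES (engine-grade, honestly, per the card): RBL (the refined one-point boundary law with
its classical leader `𝒢_v`, Bałaban's background field with Dirichlet data — 0 lines in print for conditional
one-point functions), SF (the mirror-covariance floor of that bounded classical functional, outcome-A grade if
Bałaban's averaged-observable theorem is ever proved), and ShiftCeiling (E0′-grade; it follows from the `n = 2`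
plane-resolved ceilings `MomentBounds6 G r a` — next file).  Nothing here is a claim about the floors themselves.
-/

set_option autoImplicit false

noncomputable section

open scoped SchwartzMap
open MeasureTheory Filter Topology
open Literature.MathematicalPhysics.QuantumFieldTheory Literature.MathematicalPhysics.QuantumLattice
open Literature.Probability.LatticeModels
open Summit.QuantumFields.YangMills.Cruxes.OSLegsFromFemtoAndGap.DlrCollarTransfer
open Summit.QuantumFields.YangMills.Cruxes.OSLegsFromFemtoAndGap.DlrCollarTransfer.StubLower
  (mem_cubeSites_iff exists_abs_dens_le)
open Summit.QuantumFields.YangMills.Theorems.OSLegsFromFemtoAndGap.StubLower (curvature_shift_supp_window)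
open Summit.QuantumFields.YangMills.Cruxes.NT.Reference (eventually_le_of_tendsto)

namespace Summit.QuantumFields.YangMills.Cruxes.NT.MarkovMirror

/-! ## §1 The smeared action density carried by a cube is a bounded continuous cylinder -/

section Smear

variable (G : Type) [Group G] [TopologicalSpace G] [IsTopologicalGroup G] [CompactSpace G]
  [MeasurableSpace G] [BorelSpace G] (r : LatticeRep G)

omit [Group G] [TopologicalSpace G] [IsTopologicalGroup G] [CompactSpace G] [MeasurableSpace G] [BorelSpace G] in
/-- A finite weighted sum of cylinder observables is a cylinder observable on the union of the supports. [folklore] -/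
theorem isCylinder_sum {ι : Type*} (s : Finset ι) (w : ι → ℝ) (F : ι → LGConfig 4 G → ℝ)
    (S : ι → Finset (Literature.MathematicalPhysics.QuantumLattice.ZdEdge 4)) (hF : ∀ i ∈ s, IsCylinder (F i) (S i)) :
    IsCylinder (fun U => ∑ i ∈ s, w i * F i U) (s.biUnion S) := by
  classical
  intro U V h
  refine Finset.sum_congr rfl fun i hi => ?_
  rw [hF i hi fun e he => h e (Finset.mem_coe.2 (Finset.mem_biUnion.2 ⟨i, hi, Finset.mem_coe.1 he⟩))]

/-- The cube-carried smeared action density `Ṽ = ∑_{y ∈ Q} w y · dens_y` is continuous. [folklore] -/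
theorem continuous_cubeSmear (c : Fin 4 → ℤ) (b : ℕ) (w : (Fin 4 → ℤ) → ℝ) :
    Continuous (fun U : LGConfig 4 G => ∑ y ∈ cubeSites c b, w y * dens G r y U) :=
  continuous_finsetSum _ fun y _ => continuous_const.mul (continuous_dens r y)

/-- The cube-carried smeared action density is bounded (by `(∑ |w y|) · C_dens`). [folklore] -/
theorem exists_abs_cubeSmear_le (c : Fin 4 → ℤ) (b : ℕ) (w : (Fin 4 → ℤ) → ℝ) :
    ∃ M : ℝ, ∀ U : LGConfig 4 G, |∑ y ∈ cubeSites c b, w y * dens G r y U| ≤ M := by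
  obtain ⟨C, -, hC⟩ := exists_abs_dens_le G r
  refine ⟨∑ y ∈ cubeSites c b, |w y| * C, fun U => ?_⟩
  refine (Finset.abs_sum_le_sum_abs _ _).trans (Finset.sum_le_sum fun y _ => ?_)
  rw [abs_mul]
  exact mul_le_mul_of_nonneg_left (hC y U) (abs_nonneg _)

/-- **The cube-carried smeared action density is a cylinder observable with links in the cube window `[c, c + b]`.**
[folklore] -/
theorem exists_isCylinder_cubeSmear (c : Fin 4 → ℤ) (b : ℕ) (w : (Fin 4 → ℤ) → ℝ) :
    ∃ S : Finset (Literature.MathematicalPhysics.QuantumLattice.ZdEdge 4),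
      IsCylinder (fun U : LGConfig 4 G => ∑ y ∈ cubeSites c b, w y * dens G r y U) S ∧
      ∀ e ∈ S, ∀ j, c j ≤ e.1 j ∧ e.1 j ≤ c j + b := by
  have h := isCylinder_sum G (cubeSites c b) w (dens G r) _ fun y _ => StubLower.isCylinder_dens G r y
  refine ⟨_, h, fun e he j => ?_⟩
  obtain ⟨y, hy, hey⟩ := Finset.mem_biUnion.1 he
  have h1 := curvature_shift_supp_window r y e hey j
  have h2 := (mem_cubeSites_iff _ _ _).1 hy j
  constructor <;> linarith [h1.1, h1.2, h2.1, h2.2]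

end Smear

/-! ## §2 The floor on `Q2(θv, v)` for all large couplings and all large tori -/

section Package

variable (G : Type) [Group G] [TopologicalSpace G] [IsTopologicalGroup G] [CompactSpace G]
  [MeasurableSpace G] [BorelSpace G] (r : LatticeRep G)

/-- **`Q2(θv, v) ≥ ε` eventually, from the Markov–mirror package (card E; the pointwise-in-`v` form).**
A unit map `a` (`0 < a`, `a → 0`), ONE test function `v` and `ε > 0`; for `β ≥ β₅`: a cube `Q_β = (c β, b β)` at times
`≥ 1` of physical size `(|c β j| + b β + 3)·aβ ≤ Λ₅`; a bounded continuous cylinder `W_β` carried by `Q_β` (links in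
`[c β, c β + b β]`); a bounded continuous cylinder shell functional `𝒢_β` on the closed collar (links in
`[c β − 1, c β + b β + 1]`); a reference value `p β`; with
(RBL+SUP) `|kerE_{Q_β}^ζ(W_β) − p β + 𝒢_β ζ| ≤ √ε/2` for every exterior `ζ`;
(SF) `4ε ≤ Cov_T(𝒢_β∘Θ₀, 𝒢_β)` on every torus `2L+1` with `Λ₅ ≤ aβ·L`;
(ShiftCeiling) `|Cov_T(W_β∘Θ₀, W_β) − Q2_{β,L,aβ}(θv, v)| ≤ C·aβ` for `β ≥ β₆`, `Λ₆ ≤ aβ·L`.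
Then there are `β₅'`, `Λ₅'` with `ε ≤ Q2 G r β L (a β) (θv) v` for all `β ≥ β₅'` and all `L` with `Λ₅' ≤ aβ·L`. [folklore] -/
theorem Q2_floor_of_mirrorPackage (a : ℝ → ℝ) (ha₀ : ∀ β, 0 < a β) (ha : Tendsto a atTop (𝓝 0))
    (v : 𝓢(EuclideanSpace ℝ (Fin 4), ℝ)) {ε : ℝ} (hε : 0 < ε) {β₅ Λ₅ : ℝ}
    (c : ℝ → (Fin 4 → ℤ)) (b : ℝ → ℕ) (W : ℝ → LGConfig 4 G → ℝ) (p : ℝ → ℝ) (𝒢 : ℝ → LGConfig 4 G → ℝ)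
    (hgeom : ∀ β, β₅ ≤ β → 1 ≤ c β 0 ∧ ∀ j : Fin 4, (|((c β j : ℤ) : ℝ)| + (b β : ℝ) + 3) * a β ≤ Λ₅)
    (hW : ∀ β, β₅ ≤ β → Continuous (W β) ∧ (∃ M : ℝ, ∀ U, |W β U| ≤ M) ∧
      ∃ S : Finset (Literature.MathematicalPhysics.QuantumLattice.ZdEdge 4), IsCylinder (W β) S ∧
        ∀ e ∈ S, ∀ j, c β j ≤ e.1 j ∧ e.1 j ≤ c β j + b β)
    (h𝒢 : ∀ β, β₅ ≤ β → Continuous (𝒢 β) ∧ (∃ M : ℝ, ∀ U, |𝒢 β U| ≤ M) ∧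
      ∃ S : Finset (Literature.MathematicalPhysics.QuantumLattice.ZdEdge 4), IsCylinder (𝒢 β) S ∧
        ∀ e ∈ S, ∀ j, c β j - 1 ≤ e.1 j ∧ e.1 j ≤ c β j + b β + 1)
    (hRBL : ∀ β, β₅ ≤ β → ∀ ζ, |kerE G r β (c β) (b β) ζ (W β) - p β + 𝒢 β ζ| ≤ Real.sqrt ε / 2)
    (hSF : ∀ β, β₅ ≤ β → ∀ L : ℕ, Λ₅ ≤ a β * L →
      4 * ε ≤ torusE G r β L (fun V => 𝒢 β (cfgReflect V) * 𝒢 β V) -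
        torusE G r β L (fun V => 𝒢 β (cfgReflect V)) * torusE G r β L (𝒢 β))
    (hShift : ∃ C β₆ Λ₆ : ℝ, ∀ β, β₆ ≤ β → ∀ L : ℕ, Λ₆ ≤ a β * L →
      |(torusE G r β L (fun V => W β (cfgReflect V) * W β V) -
          torusE G r β L (fun V => W β (cfgReflect V)) * torusE G r β L (W β)) -
        Q2 G r β L (a β) (thetaTest 4 v) v| ≤ C * a β) :
    ∃ β₅' Λ₅' : ℝ, ∀ β : ℝ, β₅' ≤ β → ∀ L : ℕ, Λ₅' ≤ a β * L → ε ≤ Q2 G r β L (a β) (thetaTest 4 v) v := by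
  obtain ⟨C, β₆, Λ₆, hS⟩ := hShift
  -- `a β ≤ ε / (|C| + 1)` eventually, so that the shift term `C·aβ ≤ 5ε/4`
  have hδ : 0 < ε / (|C| + 1) := div_pos hε (by positivity)
  obtain ⟨βa, hβa⟩ := eventually_le_of_tendsto ha hδ
  refine ⟨max (max β₅ β₆) (max βa 0), max Λ₅ Λ₆, fun β hβ L hL => ?_⟩
  have hβ₅ : β₅ ≤ β := le_trans (le_max_left _ _) (le_trans (le_max_left _ _) hβ)
  have hβ₆ : β₆ ≤ β := le_trans (le_max_right _ _) (le_trans (le_max_left _ _) hβ)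
  have hβa' : βa ≤ β := le_trans (le_max_left _ _) (le_trans (le_max_right _ _) hβ)
  have hβ0 : 0 ≤ β := le_trans (le_max_right _ _) (le_trans (le_max_right _ _) hβ)
  have hΛ₅ : Λ₅ ≤ a β * L := le_trans (le_max_left _ _) hL
  have hΛ₆ : Λ₆ ≤ a β * L := le_trans (le_max_right _ _) hL
  have hα : 0 < a β := ha₀ β
  obtain ⟨hc0, hsize⟩ := hgeom β hβ₅
  obtain ⟨hWc, ⟨MW, hMW⟩, SW, hWS, hSW⟩ := hW β hβ₅
  obtain ⟨h𝒢c, ⟨M𝒢, hM𝒢⟩, S𝒢, h𝒢S, hS𝒢⟩ := h𝒢 β hβ₅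
  -- the cube and its collar fit in the torus box
  have hfit : ∀ j : Fin 4, |((c β j : ℤ) : ℝ)| + (b β : ℝ) + 3 ≤ (L : ℝ) := fun j =>
    le_of_mul_le_mul_right (by nlinarith [hsize j, hΛ₅]) hα
  have hfitZ : ∀ j : Fin 4, |c β j| + (b β : ℤ) + 3 ≤ (L : ℤ) := fun j => by
    have h := hfit j
    rw [Int.cast_abs.symm] at h
    exact_mod_cast h
  have hc : ∀ j : Fin 4, -(L : ℤ) + 2 ≤ c β j ∧ c β j + (b β : ℤ) + 2 ≤ (L : ℤ) + 1 := fun j => by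
    have h := hfitZ j
    have h1 := le_abs_self (c β j)
    have h2 := neg_abs_le (c β j)
    constructor <;> linarith
  have hcL : c β 0 + (b β : ℤ) + 3 ≤ L := by linarith [hfitZ 0, le_abs_self (c β 0)]
  -- per-coupling mirror floor: `9ε/4 ≤ Cov_T(W∘Θ₀, W)`
  have hfloor := mirrorCov_ge_of_boundaryResponse G r hβ0 (c β) (b β) L hc0 hcL hc hWc hMW hWS hSW h𝒢c hM𝒢 h𝒢S hS𝒢
    hε (hRBL β hβ₅) (hSF β hβ₅ L hΛ₅)
  -- the shift term
  have hshift := hS β hβ₆ L hΛ₆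
  have hCa : C * a β ≤ 5 * ε / 4 := by
    have h1 : C * a β ≤ |C| * a β := mul_le_mul_of_nonneg_right (le_abs_self C) hα.le
    have h2 : |C| * a β ≤ |C| * (ε / (|C| + 1)) := mul_le_mul_of_nonneg_left (hβa β hβa') (abs_nonneg C)
    have h3 : |C| * (ε / (|C| + 1)) ≤ ε := by
      rw [mul_div_assoc']
      exact (div_le_iff₀ (by positivity)).2 (by nlinarith [abs_nonneg C])
    linarith
  have := (abs_le.1 hshift).2
  linarith

/-! ## §3 Clause (i) of `LowerBounds`, and `NT` by name -/

/-- **Clause (i) of `LowerBounds G r a` from the Markov–mirror package** (the card's `lowerBounds_fst_of_mmf`, with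
its sorry discharged): the hypotheses of `Q2_floor_of_mirrorPackage` for a positive-time test function `v` give the
reflected smeared two-point floor `ε ≤ Q2(θv, v)` on every large torus at every large coupling. [folklore] -/
theorem lowerBounds_fst_of_mirrorPackage (a : ℝ → ℝ) (ha₀ : ∀ β, 0 < a β) (ha : Tendsto a atTop (𝓝 0))
    (v : 𝓢(EuclideanSpace ℝ (Fin 4), ℝ)) (hv : tsupport (v : EuclideanSpace ℝ (Fin 4) → ℝ) ⊆ {y | 0 < y 0})
    {ε : ℝ} (hε : 0 < ε) {β₅ Λ₅ : ℝ}
    (c : ℝ → (Fin 4 → ℤ)) (b : ℝ → ℕ) (W : ℝ → LGConfig 4 G → ℝ) (p : ℝ → ℝ) (𝒢 : ℝ → LGConfig 4 G → ℝ)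
    (hgeom : ∀ β, β₅ ≤ β → 1 ≤ c β 0 ∧ ∀ j : Fin 4, (|((c β j : ℤ) : ℝ)| + (b β : ℝ) + 3) * a β ≤ Λ₅)
    (hW : ∀ β, β₅ ≤ β → Continuous (W β) ∧ (∃ M : ℝ, ∀ U, |W β U| ≤ M) ∧
      ∃ S : Finset (Literature.MathematicalPhysics.QuantumLattice.ZdEdge 4), IsCylinder (W β) S ∧
        ∀ e ∈ S, ∀ j, c β j ≤ e.1 j ∧ e.1 j ≤ c β j + b β)
    (h𝒢 : ∀ β, β₅ ≤ β → Continuous (𝒢 β) ∧ (∃ M : ℝ, ∀ U, |𝒢 β U| ≤ M) ∧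
      ∃ S : Finset (Literature.MathematicalPhysics.QuantumLattice.ZdEdge 4), IsCylinder (𝒢 β) S ∧
        ∀ e ∈ S, ∀ j, c β j - 1 ≤ e.1 j ∧ e.1 j ≤ c β j + b β + 1)
    (hRBL : ∀ β, β₅ ≤ β → ∀ ζ, |kerE G r β (c β) (b β) ζ (W β) - p β + 𝒢 β ζ| ≤ Real.sqrt ε / 2)
    (hSF : ∀ β, β₅ ≤ β → ∀ L : ℕ, Λ₅ ≤ a β * L →
      4 * ε ≤ torusE G r β L (fun V => 𝒢 β (cfgReflect V) * 𝒢 β V) -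
        torusE G r β L (fun V => 𝒢 β (cfgReflect V)) * torusE G r β L (𝒢 β))
    (hShift : ∃ C β₆ Λ₆ : ℝ, ∀ β, β₆ ≤ β → ∀ L : ℕ, Λ₆ ≤ a β * L →
      |(torusE G r β L (fun V => W β (cfgReflect V) * W β V) -
          torusE G r β L (fun V => W β (cfgReflect V)) * torusE G r β L (W β)) -
        Q2 G r β L (a β) (thetaTest 4 v) v| ≤ C * a β) :
    ∃ (v : 𝓢(EuclideanSpace ℝ (Fin 4), ℝ)) (ε β₅ Λ₅ : ℝ),
      tsupport (v : EuclideanSpace ℝ (Fin 4) → ℝ) ⊆ {y : EuclideanSpace ℝ (Fin 4) | 0 < y 0} ∧ 0 < ε ∧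
      ∀ β : ℝ, β₅ ≤ β → ∀ L : ℕ, Λ₅ ≤ a β * L → ε ≤ Q2 G r β L (a β) (thetaTest 4 v) v := by
  obtain ⟨β₅', Λ₅', h⟩ := Q2_floor_of_mirrorPackage G r a ha₀ ha v hε c b W p 𝒢 hgeom hW h𝒢 hRBL hSF hShift
  exact ⟨v, ε, β₅', Λ₅', hv, hε, h⟩

/-- **`NT` BY NAME from the Markov–mirror line** (the card's `nt_of_markovMirror`, now unconditional in its
bookkeeping): for every compact simple `G` (Borel σ-algebra) a representation `r`, a unit map `a` (`0 < a → 0`), the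
Markov–mirror package for ONE positive-time test function (cubes, carried observables, shell functionals, reference
values, RBL+SUP, SF, ShiftCeiling — engine-grade inputs, see the module docstring) and ANY supplier of the three-point
clause (ii) give `Summit.QuantumFields.YangMills.Theses.BalabanLadder.NT`. [folklore] -/
theorem nt_of_markovMirror
    (h : ∀ (G : Type) [Group G] [TopologicalSpace G] [IsTopologicalGroup G] [CompactSpace G],
      IsCompactSimpleLieGroup G → letI : MeasurableSpace G := borel G; haveI : BorelSpace G := ⟨rfl⟩;
      ∃ (r : LatticeRep G) (a : ℝ → ℝ), (∀ β, 0 < a β) ∧ Tendsto a atTop (𝓝 0) ∧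
        (∃ (v : 𝓢(EuclideanSpace ℝ (Fin 4), ℝ)) (ε β₅ Λ₅ : ℝ) (c : ℝ → (Fin 4 → ℤ)) (b : ℝ → ℕ)
          (W : ℝ → LGConfig 4 G → ℝ) (p : ℝ → ℝ) (𝒢 : ℝ → LGConfig 4 G → ℝ),
          tsupport (v : EuclideanSpace ℝ (Fin 4) → ℝ) ⊆ {y | 0 < y 0} ∧ 0 < ε ∧
          (∀ β, β₅ ≤ β → 1 ≤ c β 0 ∧ ∀ j : Fin 4, (|((c β j : ℤ) : ℝ)| + (b β : ℝ) + 3) * a β ≤ Λ₅) ∧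
          (∀ β, β₅ ≤ β → Continuous (W β) ∧ (∃ M : ℝ, ∀ U, |W β U| ≤ M) ∧
            ∃ S : Finset (Literature.MathematicalPhysics.QuantumLattice.ZdEdge 4), IsCylinder (W β) S ∧
              ∀ e ∈ S, ∀ j, c β j ≤ e.1 j ∧ e.1 j ≤ c β j + b β) ∧
          (∀ β, β₅ ≤ β → Continuous (𝒢 β) ∧ (∃ M : ℝ, ∀ U, |𝒢 β U| ≤ M) ∧
            ∃ S : Finset (Literature.MathematicalPhysics.QuantumLattice.ZdEdge 4), IsCylinder (𝒢 β) S ∧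
              ∀ e ∈ S, ∀ j, c β j - 1 ≤ e.1 j ∧ e.1 j ≤ c β j + b β + 1) ∧
          (∀ β, β₅ ≤ β → ∀ ζ, |kerE G r β (c β) (b β) ζ (W β) - p β + 𝒢 β ζ| ≤ Real.sqrt ε / 2) ∧
          (∀ β, β₅ ≤ β → ∀ L : ℕ, Λ₅ ≤ a β * L →
            4 * ε ≤ torusE G r β L (fun V => 𝒢 β (cfgReflect V) * 𝒢 β V) -
              torusE G r β L (fun V => 𝒢 β (cfgReflect V)) * torusE G r β L (𝒢 β)) ∧
          (∃ C β₆ Λ₆ : ℝ, ∀ β, β₆ ≤ β → ∀ L : ℕ, Λ₆ ≤ a β * L →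
            |(torusE G r β L (fun V => W β (cfgReflect V) * W β V) -
                torusE G r β L (fun V => W β (cfgReflect V)) * torusE G r β L (W β)) -
              Q2 G r β L (a β) (thetaTest 4 v) v| ≤ C * a β)) ∧
        (∃ (f g h : 𝓢(EuclideanSpace ℝ (Fin 4), ℝ)) (ε β₅ Λ₅ : ℝ), Disjoint (tsupport f) (tsupport g) ∧
          Disjoint (tsupport g) (tsupport h) ∧ Disjoint (tsupport f) (tsupport h) ∧ 0 < ε ∧
          ∀ β : ℝ, β₅ ≤ β → ∀ L : ℕ, Λ₅ ≤ a β * L → ε ≤ |Q3 G r β L (a β) f g h|)) :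
    Summit.QuantumFields.YangMills.Theses.BalabanLadder.NT := by
  intro G _ _ _ _ hG
  letI : MeasurableSpace G := borel G
  haveI : BorelSpace G := ⟨rfl⟩
  obtain ⟨r, a, ha₀, ha, ⟨v, ε, β₅, Λ₅, c, b, W, p, 𝒢, hv, hε, hgeom, hW, h𝒢, hRBL, hSF, hShift⟩, h3⟩ := h G hG
  exact ⟨r, a, ha₀, ha,
    lowerBounds_fst_of_mirrorPackage G r a ha₀ ha v hv hε c b W p 𝒢 hgeom hW h𝒢 hRBL hSF hShift, h3⟩

end Package

end Summit.QuantumFields.YangMills.Cruxes.NT.MarkovMirror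

end
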